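import Summits.QuantumFields.GaugeBoot.PeriodicPairPeel
import Literature.MathematicalPhysics.QuantumFieldTheory.PolymerCombinatorics
import HarnessLib

/-!
# Plaquette adjacency on a periodic lattice: stars, degrees, seeds (gauge-boot, L3 supplement: uniform reduced-half window, 1/6)

HONEST FRAMING (cell `pub-gaugeboot`, page 1 of every file): the venture produces certified bounds
on lattice expectations at stated coupling, gauge group, dimension and torus size; NOT a mass gap,
NOT a continuum limit, NOT a string tension; NOT Yang–Mills-summit-bearing (barriers
`FixedCouplingUltralocality`, `PerturbativeInvisibility`). This module is pure bookkeeping for a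
structural NEGATIVE result (a coupling window UNIFORM in the box for the failure of the reduced-half
in-plane reflection positivities of the square tilted boxes in `d ≥ 3`); it discharges nothing by
itself.

## Content (any periodic lattice `(A, e)` of `TiltedLatticeGauge.lean`: finite additive site group `A`, marked translations `e : Fin d → A`)

The periodic-lattice version of the cubic-torus bookkeeping `DiagonalRPTorusPlaquetteAdjacency`
(written for `(ℤ/L)^d` only), in the `plink`/`HasLink` vocabulary of `PeriodicPairPeel`, shaped
for the polymer calculus `Literature/MathematicalPhysics/QuantumFieldTheory/PolymerCombinatorics`:

* `padj e p q` — the plaquettes `p`, `q` share a link (reflexive, symmetric; the incompatibility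
  relation of the strong-coupling polymers); `plinks e q` — the (at most four) links of `q`;
  `star e ℓ` — the plaquettes through the link `ℓ`; `Touch e K q` — `q` contains a link of the
  finite link set `K` (the SEEDS of the expansion of an observable supported on `K`);
  `linksOf e Q` — the links of a plaquette set.
* The counts, all independent of the lattice: **`card_star_le`** (`#star ℓ ≤ 2d²`),
  **`card_filter_padj_le`** (adjacency degree `≤ 8d²`), **`card_filter_touch_le`**
  (`#seeds ≤ #K · 2d²`), **`card_snbhd_le`** (the seeded neighbourhood `snbhd` of the polymer
  calculus has at most `#K · 2d² + #X · 8d²` plaquettes).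
* `not_touch_of_mem_sdiff_snbhd` / `not_padj_of_mem_sdiff_snbhd` / `disjoint_plinks_of_mem_sdiff_snbhd`:
  a plaquette outside the seeded neighbourhood of `X` reads no link of `K` and no link of `X`.

Elementary; no named fact (cf. Osterwalder–Seiler, Ann. Phys. 110 (1978) 440, §3, and
Friedli–Velenik (2017) §5.2 for the polymer representation this serves).
-/

open Finset Function

namespace Summit.QuantumFields.GaugeBoot

namespace TiltedRP

namespace PairExp

open Literature.MathematicalPhysics.QuantumFieldTheory

variable {A : Type*} [AddCommGroup A] {d : ℕ} (e : Fin d → A)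

/-! ## Links of a plaquette, adjacency, seeds -/

/-- The plaquettes `p`, `q` of the periodic lattice `(A, e)` are ADJACENT: they share a link.
[shape] A parametric definition of a relation (reflexive and symmetric) — NOT a fact. [folklore] -/
def padj (p q : Plaq A d) : Prop := ∃ a b : Fin 4, plink e p a = plink e q b

/-- `padj e` is decidable (decidable site group). -/
instance instDecidablePadj [DecidableEq A] (p q : Plaq A d) : Decidable (padj e p q) := by
  unfold padj; infer_instance

/-- Adjacency is reflexive. -/
theorem padj_refl (p : Plaq A d) : padj e p p := ⟨0, 0, rfl⟩

variable {e} in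
/-- Adjacency is symmetric. -/
theorem padj_symm {p q : Plaq A d} (h : padj e p q) : padj e q p := by
  obtain ⟨a, b, hab⟩ := h
  exact ⟨b, a, hab.symm⟩

/-- `padj e` is reflexive (instance for the polymer calculus). -/
instance instReflPadj : Std.Refl (padj (d := d) e) := ⟨padj_refl e⟩

/-- `padj e` is symmetric (instance for the polymer calculus). -/
instance instSymmPadj : Std.Symm (padj (d := d) e) := ⟨fun _ _ => padj_symm⟩

variable {e} in
/-- Adjacency through `HasLink`: `p`, `q` share some link. -/
theorem padj_iff {p q : Plaq A d} : padj e p q ↔ ∃ ℓ : Link A d, HasLink e p ℓ ∧ HasLink e q ℓ := by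
  constructor
  · rintro ⟨a, b, hab⟩
    exact ⟨plink e p a, ⟨a, rfl⟩, ⟨b, hab.symm⟩⟩
  · rintro ⟨ℓ, ⟨a, ha⟩, ⟨b, hb⟩⟩
    exact ⟨a, b, ha.trans hb.symm⟩

/-- The plaquette `q` TOUCHES the link set `K`: one of its links lies in `K`. [shape] A parametric
definition of a predicate — NOT a fact. [folklore] -/
def Touch (K : Finset (Link A d)) (q : Plaq A d) : Prop := ∃ a : Fin 4, plink e q a ∈ K

variable {e} in
/-- Touching through `HasLink`. -/
theorem touch_iff {K : Finset (Link A d)} {q : Plaq A d} :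
    Touch e K q ↔ ∃ ℓ ∈ K, HasLink e q ℓ := by
  constructor
  · rintro ⟨a, ha⟩
    exact ⟨_, ha, a, rfl⟩
  · rintro ⟨ℓ, hℓ, a, rfl⟩
    exact ⟨a, hℓ⟩

/-- The links of a plaquette, as a finset. -/
def plinks [DecidableEq A] (q : Plaq A d) : Finset (Link A d) := univ.image (plink e q)

section Dec

variable [DecidableEq A]

variable {e} in
/-- Membership in `plinks`. -/
theorem mem_plinks {q : Plaq A d} {ℓ : Link A d} : ℓ ∈ plinks e q ↔ HasLink e q ℓ := by
  simp [plinks, HasLink]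

/-- `plink e q a ∈ plinks e q`. -/
theorem plink_mem_plinks (q : Plaq A d) (a : Fin 4) : plink e q a ∈ plinks e q :=
  mem_plinks.2 ⟨a, rfl⟩

/-- A plaquette has at most four links. -/
theorem card_plinks_le (q : Plaq A d) : (plinks e q).card ≤ 4 :=
  card_image_le.trans (by simp)

variable {e} in
/-- Adjacent plaquettes have non-disjoint link sets, and conversely. -/
theorem padj_iff_not_disjoint {p q : Plaq A d} :
    padj e p q ↔ ¬ Disjoint (plinks e p) (plinks e q) := by
  rw [padj_iff, not_disjoint_iff]
  simp only [mem_plinks]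

/-- `Touch e K` is decidable. -/
instance instDecidableTouch (K : Finset (Link A d)) (q : Plaq A d) : Decidable (Touch e K q) := by
  unfold Touch; infer_instance

variable {e} in
/-- A plaquette not touching `K` has its links outside `K`. -/
theorem disjoint_plinks_of_not_touch {K : Finset (Link A d)} {q : Plaq A d} (h : ¬ Touch e K q) :
    Disjoint (plinks e q) K := by
  rw [disjoint_left]
  intro ℓ hℓ hℓK
  exact h (touch_iff.2 ⟨ℓ, hℓK, mem_plinks.1 hℓ⟩)

/-- The links of a set of plaquettes. -/
def linksOf (Q : Finset (Plaq A d)) : Finset (Link A d) := Q.biUnion (plinks e)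

variable {e} in
/-- Membership in `linksOf`. -/
theorem mem_linksOf {Q : Finset (Plaq A d)} {ℓ : Link A d} :
    ℓ ∈ linksOf e Q ↔ ∃ q ∈ Q, HasLink e q ℓ := by
  simp [linksOf, mem_plinks]

variable {e} in
/-- `linksOf` is monotone. -/
theorem linksOf_mono {Q Q' : Finset (Plaq A d)} (h : Q ⊆ Q') : linksOf e Q ⊆ linksOf e Q' :=
  biUnion_subset_biUnion_of_subset_left _ h

variable {e} in
/-- The links of a member lie in `linksOf`. -/
theorem plinks_subset_linksOf {Q : Finset (Plaq A d)} {q : Plaq A d} (hq : q ∈ Q) :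
    plinks e q ⊆ linksOf e Q :=
  subset_biUnion_of_mem (plinks e) hq

/-! ## Outside the seeded neighbourhood -/

section Outside

variable {e} {K : Finset (Link A d)} {P X : Finset (Plaq A d)} {q : Plaq A d}

/-- A plaquette outside the seeded neighbourhood does not touch the seeds. -/
theorem not_touch_of_mem_sdiff_snbhd (hq : q ∈ P \ Polymer.snbhd (padj e) (Touch e K) P X) :
    ¬ Touch e K q := fun h =>
  (mem_sdiff.1 hq).2 (Polymer.mem_snbhd.2 ⟨(mem_sdiff.1 hq).1, Or.inl h⟩)

/-- A plaquette outside the seeded neighbourhood of `X` is adjacent to no plaquette of `X`. -/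
theorem not_padj_of_mem_sdiff_snbhd (hq : q ∈ P \ Polymer.snbhd (padj e) (Touch e K) P X)
    {x : Plaq A d} (hx : x ∈ X) : ¬ padj e x q := fun h =>
  (mem_sdiff.1 hq).2 (Polymer.mem_snbhd.2 ⟨(mem_sdiff.1 hq).1, Or.inr ⟨x, hx, h⟩⟩)

/-- **Link avoidance**: a plaquette outside the seeded neighbourhood of `X` reads no link of
`K ∪ linksOf X`. -/
theorem disjoint_plinks_of_mem_sdiff_snbhd (hq : q ∈ P \ Polymer.snbhd (padj e) (Touch e K) P X) :
    Disjoint (K ∪ linksOf e X) (plinks e q) := by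
  rw [disjoint_union_left]
  refine ⟨(disjoint_plinks_of_not_touch (not_touch_of_mem_sdiff_snbhd hq)).symm, ?_⟩
  unfold linksOf
  rw [disjoint_biUnion_left]
  intro x hx
  by_contra h
  exact not_padj_of_mem_sdiff_snbhd hq hx (padj_iff_not_disjoint.2 h)

/-- **Link avoidance for a set**: the links of `Q₂ ⊆ P ∖ snbhd X` avoid `K ∪ linksOf X`. -/
theorem disjoint_linksOf_of_subset_sdiff_snbhd {Q₂ : Finset (Plaq A d)}
    (h₂ : Q₂ ⊆ P \ Polymer.snbhd (padj e) (Touch e K) P X) :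
    Disjoint (K ∪ linksOf e X) (linksOf e Q₂) := by
  unfold linksOf
  rw [disjoint_biUnion_right]
  intro q hq
  exact disjoint_plinks_of_mem_sdiff_snbhd (h₂ hq)

end Outside

/-! ## The counts (all independent of the lattice) -/

section Counts

variable [Fintype A]

/-- The STAR of a link: the plaquettes containing it. -/
def star (ℓ : Link A d) : Finset (Plaq A d) := univ.filter fun q => HasLink e q ℓ

variable {e} in
/-- Membership in the star. -/
theorem mem_star {ℓ : Link A d} {q : Plaq A d} : q ∈ star e ℓ ↔ HasLink e q ℓ := by
  simp [star]

omit [Fintype A] [DecidableEq A] in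
variable {e} in
/-- The base point of a plaquette through `(s, m)` other than `s` is determined by its plane: it is
`s - e_l` if the plane is `(m, l)` and `s - e_k` if the plane is `(k, m)`. -/
theorem fst_eq_of_hasLink_of_ne {q : Plaq A d} {s : A} {m : Fin d}
    (h : HasLink e q (s, m)) (hs : q.1 ≠ s) :
    q.1 = if q.2.1.1 = m then s - e q.2.1.2 else s - e q.2.1.1 := by
  rw [hasLink_iff] at h
  have hne : q.2.1.1 ≠ q.2.1.2 := ne_of_lt q.2.2
  simp only [Prod.mk.injEq] at h
  rcases h with ⟨h1, -⟩ | ⟨h1, h2⟩ | ⟨h1, h2⟩ | ⟨h1, -⟩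
  · exact absurd h1.symm hs
  · rw [if_neg (fun h' => hne (h'.trans h2)), h1, add_sub_cancel_right]
  · rw [if_pos h2.symm, h1, add_sub_cancel_right]
  · exact absurd h1.symm hs

/-- **A link lies in at most `2d²` plaquettes** (in fact `2(d-1)`; any lattice-independent bound
suffices here). -/
theorem card_star_le (ℓ : Link A d) : (star e ℓ).card ≤ 2 * d ^ 2 := by
  classical
  obtain ⟨s, m⟩ := ℓ
  -- inject `q ↦ (plane of q, [q is based at s])` into `planes × Bool`
  have hinj : Set.InjOn (fun q : Plaq A d => (q.2, decide (q.1 = s))) (star e (s, m)) := by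
    intro q hq q' hq' hqq'
    simp only [Prod.mk.injEq, decide_eq_decide] at hqq'
    obtain ⟨h2, h1⟩ := hqq'
    have hq1 := mem_star.1 (mem_coe.1 hq)
    have hq'1 := mem_star.1 (mem_coe.1 hq')
    refine Prod.ext ?_ h2
    by_cases hqs : q.1 = s
    · rw [hqs, (h1.1 hqs)]
    · have hq's : q'.1 ≠ s := fun h => hqs (h1.2 h)
      rw [fst_eq_of_hasLink_of_ne hq1 hqs, fst_eq_of_hasLink_of_ne hq'1 hq's, h2]
  have hmaps : Set.MapsTo (fun q : Plaq A d => (q.2, decide (q.1 = s))) (star e (s, m))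
      (univ : Finset (DirPair d × Bool)) := fun _ _ => mem_coe.2 (mem_univ _)
  calc (star e (s, m)).card ≤ (univ : Finset (DirPair d × Bool)).card :=
        card_le_card_of_injOn _ hmaps hinj
    _ = Fintype.card (DirPair d) * 2 := by
        rw [card_univ, Fintype.card_prod, Fintype.card_bool]
    _ ≤ (d * d) * 2 := by
        refine Nat.mul_le_mul_right 2 ?_
        exact (Fintype.card_subtype_le _).trans (by rw [Fintype.card_prod, Fintype.card_fin])
    _ = 2 * d ^ 2 := by ring

/-- **Degree bound**: a plaquette is adjacent to at most `8d²` plaquettes (within any region). -/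
theorem card_filter_padj_le (a : Plaq A d) (P : Finset (Plaq A d)) :
    (P.filter (padj e a)).card ≤ 8 * d ^ 2 := by
  have hsub : P.filter (padj e a) ⊆ (univ : Finset (Fin 4)).biUnion fun b => star e (plink e a b) := by
    intro q hq
    obtain ⟨b, c, hbc⟩ := (mem_filter.1 hq).2
    exact mem_biUnion.2 ⟨b, mem_univ _, mem_star.2 ⟨c, hbc.symm⟩⟩
  refine (card_le_card hsub).trans (card_biUnion_le.trans ?_)
  calc ∑ b : Fin 4, (star e (plink e a b)).card ≤ ∑ _b : Fin 4, 2 * d ^ 2 :=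
        sum_le_sum fun b _ => card_star_le e (plink e a b)
    _ = 8 * d ^ 2 := by rw [sum_const, card_univ, Fintype.card_fin, smul_eq_mul]; ring

/-- **Seed bound**: at most `#K · 2d²` plaquettes touch the link set `K` (within any region). -/
theorem card_filter_touch_le (K : Finset (Link A d)) (P : Finset (Plaq A d)) :
    (P.filter (Touch e K)).card ≤ K.card * (2 * d ^ 2) := by
  have hsub : P.filter (Touch e K) ⊆ K.biUnion (star e) := by
    intro q hq
    obtain ⟨a, ha⟩ := (mem_filter.1 hq).2
    exact mem_biUnion.2 ⟨_, ha, mem_star.2 ⟨a, rfl⟩⟩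
  refine (card_le_card hsub).trans (card_biUnion_le.trans ?_)
  calc ∑ ℓ ∈ K, (star e ℓ).card ≤ ∑ _ℓ ∈ K, 2 * d ^ 2 := sum_le_sum fun ℓ _ => card_star_le e ℓ
    _ = K.card * (2 * d ^ 2) := by rw [sum_const, smul_eq_mul]

/-- **The seeded neighbourhood is small**: `#snbhd P X ≤ #K · 2d² + #X · 8d²`. -/
theorem card_snbhd_le (K : Finset (Link A d)) (P X : Finset (Plaq A d)) :
    (Polymer.snbhd (padj e) (Touch e K) P X).card ≤ K.card * (2 * d ^ 2) + X.card * (8 * d ^ 2) := by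
  have hsub : Polymer.snbhd (padj e) (Touch e K) P X ⊆
      P.filter (Touch e K) ∪ X.biUnion fun x => P.filter (padj e x) := by
    intro q hq
    obtain ⟨hqP, h⟩ := Polymer.mem_snbhd.1 hq
    rcases h with h | ⟨x, hx, hxq⟩
    · exact mem_union_left _ (mem_filter.2 ⟨hqP, h⟩)
    · exact mem_union_right _ (mem_biUnion.2 ⟨x, hx, mem_filter.2 ⟨hqP, hxq⟩⟩)
  refine (card_le_card hsub).trans ((card_union_le _ _).trans (Nat.add_le_add
    (card_filter_touch_le e K P) (card_biUnion_le.trans ?_)))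
  calc ∑ x ∈ X, (P.filter (padj e x)).card ≤ ∑ _x ∈ X, 8 * d ^ 2 :=
        sum_le_sum fun x _ => card_filter_padj_le e x P
    _ = X.card * (8 * d ^ 2) := by rw [sum_const, smul_eq_mul]

/-- The complement in `P` of `P ∖ snbhd` is small: `#(P ∖ (P ∖ snbhd)) ≤ #K · 2d² + #X · 8d²`
(the form used for the partition-function ratios). -/
theorem card_sdiff_sdiff_snbhd_le (K : Finset (Link A d)) (P X : Finset (Plaq A d)) :
    (P \ (P \ Polymer.snbhd (padj e) (Touch e K) P X)).card ≤
      K.card * (2 * d ^ 2) + X.card * (8 * d ^ 2) := by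
  rw [sdiff_sdiff_right_self]
  exact (card_le_card inter_subset_right).trans (card_snbhd_le e K P X)

end Counts

end Dec

end PairExp

end TiltedRP

end Summit.QuantumFields.GaugeBoot
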